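import Summits.AtomisticToContinuum.HydrodynamicLimit.Theorems.OneFlightGossipEngineCollisionActivityTailsAbnormalActivityTagged
import Summits.AtomisticToContinuum.HydrodynamicLimit.Theorems.OneFlightGossipEngineCollisionActivityTailsTaggedPerPairTT
import HarnessLib

/-!
# `CollisionActivityTails` (stmt-AtomisticToContinuum-13734), line `plaque-thinning-count-ld`, stub T₂b: the tagged half from a
label-set envelope with TWO tagging thresholds (`stub_taggedFromLabelEnvelopeTT`)

Helper file (`--supports stmt-AtomisticToContinuum-13734`) of the crux
`Summit.AtomisticToContinuum.HydrodynamicLimit.Theses.OneFlightGossipEngine.CollisionActivityTails`, skeleton line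
`plaque-thinning-count-ld` (v12), registered stub T₂b `stub_taggedFromLabelEnvelopeTT : TaggedPerPair₂ → LabelEnvelopeFromEnvelope →
TaggedFromEnvelope₂`: under the true local Gibbs law the tagged cold window activity with a COUNT threshold `yc` and a KINETIC threshold
`yk` is small in mean, from a label-set law envelope of the laws at the times of the window, the count threshold lying in the dense-phase
range `yc σ³ ≤ 1` under the TEMPERATURE-FREE diluteness clause `C (2π/β)^{3/2} σ³ ≤ 1/100`.

Two-threshold PORT of the landed one-threshold tagged half (`…AbnormalActivityTaggedMajorant` §8, p135132; `…AbnormalActivityTagged`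
§9–§10, p135296): §8₂ the tagged mark `tagMark₂ = 𝟙{Tagged₂} |v_k - v_l|`, its majorant read at the grid time
`tagMajor₂ = |v_k - v_l| (𝟙{∃ j, U < |v_j|} + 𝟙{TaggedPlus₂})` (radii enlarged by `δ = 2U · mesh`, `tagMark₂_freeFlight_le`), measurable;
§9₂ the pathwise bound `ofReal_sum_tagAct₂_le`; §10₂ the assembly `lintegral_tagAct₂_le` (scale `K` with `44 σ³ C² J 2^{-K} ≤ η`, `N₀(τ)`
with `w_N < t₁ - t`, speed cap, mesh, the window inequality `exists_measurable_majorant_collisionSum_of_forall_le` with swept-tube events and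
the majorant `tagMajor₂`, the per-pair bound `TaggedPerPair₂` of stub T₂a — a HYPOTHESIS here, landed p144543 —, `liminf_M`, constants
`4σ³`) and `taggedSmallOn₂_of_labelEnvelopeOn`: `A = C(2π/β)^{3/2} ≥ 1` by total mass, `yc := 100 A` (`yc σ³ ≤ 1` IS the clause),
`yk := 200 A β⁻¹`. `Tagged₂`, `tagAct₂`, `TaggedSmallOn₂`, `TaggedFromEnvelope₂` are VERBATIM copies of the skeleton's; `ScaleTag₂`,
`TaggedPlus₂`, `TaggedPerPair₂` are imported from the sibling `…CollisionActivityTailsTaggedPerPairTT` (verbatim copies there). Own namespace.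

References: C. Cercignani, R. Illner, M. Pulvirenti, *The Mathematical Theory of Dilute Gases* (1994), §4.3, App. 4.A (collision
cylinders, collision sums along the hard-sphere flow); I. Gallagher, L. Saint-Raymond, B. Texier, *From Newton to Boltzmann* (2013),
Ch. 4. Elementary measure theory and bookkeeping; recorded here.
-/

noncomputable section

open MeasureTheory Set Filter Topology
open scoped ENNReal

namespace Summit.AtomisticToContinuum.HydrodynamicLimit.Theorems.CollisionActivityTailsTaggedTT

open Literature.MathematicalPhysics.KineticTheory Literature.Analysis.FluidPDE
open Summit.AtomisticToContinuum.HydrodynamicLimit.Theorems.CollisionActivityTailsActivityDomination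
  (Flow Cfg window act tdist nearCount collisionPairSum_nonneg window_pos)
open Summit.AtomisticToContinuum.HydrodynamicLimit.Theorems.CollisionActivityTailsAbnormalActivityStatics
  (windowEvent measurableSet_windowEvent mem_windowEvent_of_contact)
open Summit.AtomisticToContinuum.HydrodynamicLimit.Theorems.CollisionActivityTailsEndpointTails (ae_mem_good_localGibbsLaw)
open Summit.AtomisticToContinuum.HydrodynamicLimit.Theorems.CollisionActivityTailsAbnormalActivity
  (rec imp relSpeed scaleRadius ballKinetic EnvelopeOn imp_le_relSpeed hsDiameter_sq_mul_window eventually_window_lt)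
open Summit.AtomisticToContinuum.HydrodynamicLimit.Theorems.CollisionActivityTailsEnvelopePlumbing
  (LabelLawEnvelope LabelEnvelopeOn LabelEnvelopeFromEnvelope)
open Summit.AtomisticToContinuum.HydrodynamicLimit.Theorems.CollisionActivityTailsAbnormalActivityTagged
  (tubePair fluxJ fluxJ_lt_top one_le_envelopeConst exists_speedCap exists_scaleK nearCount_freeFlight_le
    ballKinetic_freeFlight_le measurable_nearCount_real measurable_ballKinetic measurableSet_cap
    indicator_windowEvent_eq_tubePair scaleRadius_pos)
open Summit.AtomisticToContinuum.HydrodynamicLimit.Theorems.CollisionActivityTailsTaggedPerPairTT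
  (ScaleTag₂ TaggedPlus₂ TaggedPerPair₂)

/-! ## §0 Vocabulary (VERBATIM copies of the skeleton's `Tagged₂`, `tagAct₂`, `TaggedSmallOn₂`, `TaggedFromEnvelope₂`) -/

variable {σ : ℝ} {N : ℕ}

/-- Particle `i` is **tagged with two thresholds** (count threshold `yc`, kinetic threshold `yk`, minimal scale `K`) in `cfg`: at some
scale `K' ≥ max K 1` the ball of mean occupancy `K'` around `i` holds at least `yc K'` centres OR kinetic energy (twice) at least `yk K'`. -/
def Tagged₂ (yc yk : ℝ) (K : ℕ) (cfg : Cfg N) (i : Fin (N + 1)) : Prop :=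
  ∃ K' : ℕ, K ≤ K' ∧ 1 ≤ K' ∧
    (yc * K' ≤ (nearCount cfg i (scaleRadius N K') : ℝ) ∨ yk * K' ≤ ballKinetic cfg i (scaleRadius N K'))

open scoped Classical in
/-- **Tagged cold activity** `tagAct₂`: cold collisions of `i` at which `i` IS tagged (two thresholds). -/
def tagAct₂ (Θ yc yk : ℝ) (K : ℕ) (Φ : Flow σ N) (τ s : ℝ) (i : Fin (N + 1)) (z : Cfg N) : ℝ :=
  σ / τ * Φ.collisionPairSum (Set.Ioc s (s + window τ N))
    (fun t cfg k l => if k = i ∧ relSpeed cfg k l ≤ Θ ∧ Tagged₂ yc yk K cfg i then imp σ N cfg t k l else 0) z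

/-- **TAGGED COLD ACTIVITY SMALL IN MEAN on the horizon `t`, two thresholds**: a count threshold `yc` in the dense-phase range `yc σ³ ≤ 1`
and a kinetic threshold `yk` such that for every cold cap `Θ` and accuracy `η` some minimal scale `K` gives, for every `τ > 0`,
`N ≥ N₀(τ)` and all starts `s ≤ t`, `E_{λ₀}[(N+1)⁻¹ Σ_i tagAct₂_i] ≤ η`. -/
def TaggedSmallOn₂ (σ : ℝ) (a₀ θ₀ : T3 → ℝ) (u₀ : T3 → V3) (Φ : (N : ℕ) → Flow σ N) (t : ℝ) : Prop :=
  ∃ yc : ℝ, 0 < yc ∧ yc * σ ^ 3 ≤ 1 ∧ ∃ yk : ℝ, 0 < yk ∧ ∀ Θ : ℝ, 0 < Θ → ∀ η : ℝ, 0 < η →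
    ∃ K : ℕ, ∀ τ : ℝ, 0 < τ → ∃ N₀ : ℕ, ∀ N : ℕ, N₀ ≤ N → ∀ s ∈ Set.Icc 0 t,
      ∫⁻ z, ENNReal.ofReal (((N : ℝ) + 1)⁻¹ * ∑ i : Fin (N + 1), tagAct₂ Θ yc yk K (Φ N) τ s i z)
        ∂(localGibbsLaw σ a₀ u₀ θ₀ N (Φ N)) ≤ ENNReal.ofReal η

/-- **TAGGED HALF FROM A DILUTE ENVELOPE, LOCALLY, two thresholds** — typed against the TEMPERATURE-FREE diluteness clause
`C (2π/β)^{3/2} σ³ ≤ κ₅` (the count series needs `yc ≥ 100 A`, `A = C(2π/β)^{3/2}`, and `yc σ³ ≤ 1`; the kinetic series runs at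
`yk = 200 A β⁻¹`, free). -/
def TaggedFromEnvelope₂ : Prop :=
  ∀ (a₀ θ₀ : T3 → ℝ) (u₀ : T3 → V3), Continuous a₀ → Continuous θ₀ → Continuous u₀ →
    (∀ x, 0 < a₀ x) → (∀ x, 0 < θ₀ x) → ∃ κ₅ : ℝ, 0 < κ₅ ∧ ∃ σ₅ : ℝ, 0 < σ₅ ∧ ∀ σ : ℝ, 0 < σ → σ < σ₅ →
    ∀ (Φ : (N : ℕ) → Flow σ N) (t t₁ β C : ℝ), 0 ≤ t → t < t₁ → 0 < β → 0 ≤ C →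
      C * (2 * Real.pi / β) ^ (3 / 2 : ℝ) * σ ^ 3 ≤ κ₅ →
      EnvelopeOn σ a₀ θ₀ u₀ Φ t₁ β C → TaggedSmallOn₂ σ a₀ θ₀ u₀ Φ t

/-! ## §8₂ The tagged mark with two thresholds, its majorant at the grid time, measurability (port of `…TaggedMajorant` §8) -/

open scoped Classical in
/-- THE TAGGED MARK of an ordered pair, two thresholds: `𝟙{k tagged} |v_k - v_l|` (dominates the tagged cold summand). -/
def tagMark₂ (yc yk : ℝ) (K : ℕ) (w : Cfg N) (k l : Fin (N + 1)) : ℝ≥0∞ :=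
  if Tagged₂ yc yk K w k then ENNReal.ofReal ‖(w k).2 - (w l).2‖ else 0

open scoped Classical in
/-- THE MAJORANT of the two-threshold tagged mark at the grid time: `|v_k - v_l| (𝟙{some speed > U} + 𝟙{TaggedPlus₂})`. -/
def tagMajor₂ (yc yk δ U : ℝ) (K : ℕ) (w : Cfg N) (k l : Fin (N + 1)) : ℝ≥0∞ :=
  ENNReal.ofReal ‖(w k).2 - (w l).2‖ * ((if ∃ j, U < ‖(w j).2‖ then 1 else 0) + (if TaggedPlus₂ yc yk δ K w k then 1 else 0))

/-- **DOMINATION ALONG THE BACKWARD FREE FLIGHT** (hypothesis `hFt` of the window inequality), two thresholds: for `0 ≤ t`, `2 U t ≤ δ`,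
the tagged mark of the flown configuration is at most the majorant at the grid configuration (either some speed exceeds `U`, or all
centres moved by `≤ U t` and the tag survives at the same scale with radii enlarged by `δ`, for each threshold separately). -/
theorem tagMark₂_freeFlight_le {yc yk δ U : ℝ} {K : ℕ} {t : ℝ} (ht : 0 ≤ t) (htδ : 2 * U * t ≤ δ) (w : Cfg N)
    (k l : Fin (N + 1)) :
    tagMark₂ yc yk K (freeFlight (Torus.geometry (Fin 3)) (-t) w) k l ≤ tagMajor₂ yc yk δ U K w k l := by
  -- adapted from `tagMark_freeFlight_le` (one threshold) of `…AbnormalActivityTaggedMajorant`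
  classical
  unfold tagMark₂ tagMajor₂
  have hvk : (freeFlight (Torus.geometry (Fin 3)) (-t) w k).2 = (w k).2 := by simp [freeFlight_apply]
  have hvl : (freeFlight (Torus.geometry (Fin 3)) (-t) w l).2 = (w l).2 := by simp [freeFlight_apply]
  rw [hvk, hvl]
  by_cases hT : Tagged₂ yc yk K (freeFlight (Torus.geometry (Fin 3)) (-t) w) k
  · rw [if_pos hT]
    by_cases hcap : ∃ j, U < ‖(w j).2‖
    · rw [if_pos hcap]
      exact le_mul_of_one_le_right' le_self_add
    · rw [if_neg hcap]
      simp only [not_exists, not_lt] at hcap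
      have hplus : TaggedPlus₂ yc yk δ K w k := by
        obtain ⟨K', hKK', -, hor⟩ := hT
        refine ⟨K' - K, ?_⟩
        rw [Nat.add_sub_cancel' hKK']
        rcases hor with hc | hk
        · exact Or.inl (hc.trans (by exact_mod_cast nearCount_freeFlight_le ht htδ hcap k _))
        · exact Or.inr (hk.trans (ballKinetic_freeFlight_le ht htδ hcap k _))
      rw [if_pos hplus, zero_add, mul_one]
  · rw [if_neg hT]
    exact bot_le

/-- The enlarged tagging with two thresholds is a measurable event (countable union over the scales of the enlarged scale tags). -/
theorem measurableSet_taggedPlus₂ (yc yk δ : ℝ) (K : ℕ) (k : Fin (N + 1)) :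
    MeasurableSet {w : Cfg N | TaggedPlus₂ yc yk δ K w k} := by
  have h : {w : Cfg N | TaggedPlus₂ yc yk δ K w k} = ⋃ j : ℕ, {w : Cfg N | ScaleTag₂ yc yk δ (K + j) w k} := by
    ext w; simp [TaggedPlus₂]
  rw [h]
  exact MeasurableSet.iUnion fun j => (measurableSet_le measurable_const (measurable_nearCount_real k _)).union
    (measurableSet_le measurable_const (measurable_ballKinetic k _))

/-- The two-threshold majorant is a measurable function of the configuration (hypothesis `hFtm` of the window inequality). -/
theorem measurable_tagMajor₂ (yc yk δ U : ℝ) (K : ℕ) (k l : Fin (N + 1)) :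
    Measurable fun w : Cfg N => tagMajor₂ yc yk δ U K w k l := by
  classical
  unfold tagMajor₂
  refine ((measurable_pi_apply k).snd.sub (measurable_pi_apply l).snd).norm.ennreal_ofReal.mul ?_
  exact (Measurable.ite (measurableSet_cap U) measurable_const measurable_const).add
    (Measurable.ite (measurableSet_taggedPlus₂ yc yk δ K k) measurable_const measurable_const)

/-! ## §9₂ The tagged cold activity as a window collision sum of the tagged mark (port of `…AbnormalActivityTagged` §9) -/

open scoped Classical in
/-- The two-threshold tagged cold summand of one particle is dominated by the tagged mark:
`ofReal (𝟙{k = i, |g| ≤ Θ, Tagged₂} |Δv_k|) ≤ 𝟙{k = i} tagMark₂`. -/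
theorem ofReal_tagSummand₂_le (Θ yc yk : ℝ) (K : ℕ) (w : Cfg N) (t : ℝ) (i k l : Fin (N + 1)) :
    ENNReal.ofReal (if k = i ∧ relSpeed w k l ≤ Θ ∧ Tagged₂ yc yk K w i then imp σ N w t k l else 0) ≤
      if k = i then tagMark₂ yc yk K w k l else 0 := by
  by_cases hk : k = i
  · subst hk
    rw [if_pos rfl]
    unfold tagMark₂
    by_cases hT : Tagged₂ yc yk K w k
    · rw [if_pos hT]
      split_ifs
      · exact ENNReal.ofReal_le_ofReal (imp_le_relSpeed w t k l)
      · simp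
    · rw [if_neg hT, if_neg (fun h => hT h.2.2), ENNReal.ofReal_zero]
  · rw [if_neg (fun h => hk h.1), if_neg hk, ENNReal.ofReal_zero]

/-- **The normalised two-threshold tagged cold activity is dominated by a window collision sum of the tagged mark.** On the good set,
`ofReal((N+1)⁻¹ Σ_i tagAct₂_i z) ≤ ofReal((N+1)⁻¹ σ/τ) · Σ_{collision times r ∈ [s, s+w]} Σ_{k ≠ l in contact} tagMark₂ (Φ_r z) k l`
(`τ, σ ≥ 0`; each collision of `i` is the ordered contact pair `(i, partner)`, `Σ_i 𝟙{k = i} = 1`, `|Δv_k| ≤ |v_k - v_l|`). -/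
theorem ofReal_sum_tagAct₂_le (hσ : 0 ≤ σ) (Θ yc yk : ℝ) (K : ℕ) (Φ : Flow σ N) {τ : ℝ} (hτ : 0 ≤ τ) (s : ℝ) {z : Cfg N}
    (hz : z ∈ Φ.good) :
    ENNReal.ofReal (((N : ℝ) + 1)⁻¹ * ∑ i : Fin (N + 1), tagAct₂ Θ yc yk K Φ τ s i z) ≤
      ENNReal.ofReal (((N : ℝ) + 1)⁻¹ * (σ / τ)) *
        ∑ᶠ r ∈ collisionTimes (Torus.geometry (Fin 3)) (hsDiameter σ N) (fun t => Φ.flow t z) ∩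
            Icc s (s + window τ N),
          ∑ k : Fin (N + 1), ∑ l : Fin (N + 1),
            (if k ≠ l ∧ ‖(Torus.geometry (Fin 3)).sepVec (Φ.flow r z k).1 (Φ.flow r z l).1‖ = hsDiameter σ N
              then tagMark₂ yc yk K (Φ.flow r z) k l else 0) := by
  -- adapted from `ofReal_sum_tagAct_le` (one threshold) of `…AbnormalActivityTagged`
  classical
  set G := Torus.geometry (Fin 3)
  set ε := hsDiameter σ N
  have hfinI : (collisionTimes G ε (fun t => Φ.flow t z) ∩ Ioc s (s + window τ N)).Finite :=
    Φ.finite_collisionTimes_inter hz Ioc_subset_Icc_self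
  have hfinC : (collisionTimes G ε (fun t => Φ.flow t z) ∩ Icc s (s + window τ N)).Finite :=
    Φ.finite_collisionTimes_inter hz Subset.rfl
  have hc : 0 ≤ ((N : ℝ) + 1)⁻¹ * (σ / τ) := mul_nonneg (inv_nonneg.2 (by positivity)) (div_nonneg hσ hτ)
  have hsum : ∑ i : Fin (N + 1), tagAct₂ Θ yc yk K Φ τ s i z = σ / τ * ∑ i : Fin (N + 1),
      Φ.collisionPairSum (Ioc s (s + window τ N))
        (fun t cfg k l => if k = i ∧ relSpeed cfg k l ≤ Θ ∧ Tagged₂ yc yk K cfg i then imp σ N cfg t k l else 0) z := by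
    unfold tagAct₂; rw [Finset.mul_sum]
  have hnn : ∀ (i : Fin (N + 1)) t (cfg : Cfg N) k l,
      0 ≤ (if k = i ∧ relSpeed cfg k l ≤ Θ ∧ Tagged₂ yc yk K cfg i then imp σ N cfg t k l else 0) := by
    intro i t cfg k l; split_ifs; exacts [norm_nonneg _, le_rfl]
  rw [hsum, ← mul_assoc, ENNReal.ofReal_mul hc]
  gcongr
  rw [ENNReal.ofReal_sum_of_nonneg fun i _ => collisionPairSum_nonneg Φ _ (hnn i) z]
  have hstep : ∀ i : Fin (N + 1), ENNReal.ofReal (Φ.collisionPairSum (Ioc s (s + window τ N))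
      (fun t cfg k l => if k = i ∧ relSpeed cfg k l ≤ Θ ∧ Tagged₂ yc yk K cfg i then imp σ N cfg t k l else 0) z) ≤
      ∑ r ∈ hfinC.toFinset, ∑ p ∈ contactPairs G ε (Φ.flow r z),
        (if p.1 = i then tagMark₂ yc yk K (Φ.flow r z) p.1 p.2 else 0) := by
    intro i
    unfold HardSphereFlow.collisionPairSum
    rw [collisionPairSum_eq_finset_sum hfinI,
      ENNReal.ofReal_sum_of_nonneg fun r _ => Finset.sum_nonneg fun p _ => hnn i _ _ _ _]
    calc ∑ r ∈ hfinI.toFinset, ENNReal.ofReal (∑ p ∈ contactPairs G ε (Φ.flow r z),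
            (if p.1 = i ∧ relSpeed (Φ.flow r z) p.1 p.2 ≤ Θ ∧ Tagged₂ yc yk K (Φ.flow r z) i
              then imp σ N (Φ.flow r z) r p.1 p.2 else 0))
        = ∑ r ∈ hfinI.toFinset, ∑ p ∈ contactPairs G ε (Φ.flow r z), ENNReal.ofReal
            (if p.1 = i ∧ relSpeed (Φ.flow r z) p.1 p.2 ≤ Θ ∧ Tagged₂ yc yk K (Φ.flow r z) i
              then imp σ N (Φ.flow r z) r p.1 p.2 else 0) :=
          Finset.sum_congr rfl fun r _ => ENNReal.ofReal_sum_of_nonneg fun p _ => hnn i _ _ _ _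
      _ ≤ ∑ r ∈ hfinI.toFinset, ∑ p ∈ contactPairs G ε (Φ.flow r z),
            (if p.1 = i then tagMark₂ yc yk K (Φ.flow r z) p.1 p.2 else 0) :=
          Finset.sum_le_sum fun r _ => Finset.sum_le_sum fun p _ => ofReal_tagSummand₂_le Θ yc yk K _ r i p.1 p.2
      _ ≤ _ := by
          refine Finset.sum_le_sum_of_subset_of_nonneg (fun r hr => ?_) fun _ _ _ => bot_le
          rw [Set.Finite.mem_toFinset] at hr ⊢
          exact ⟨hr.1, Ioc_subset_Icc_self hr.2⟩
  refine (Finset.sum_le_sum fun i _ => hstep i).trans (le_of_eq ?_)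
  rw [Finset.sum_comm, finsum_mem_eq_finite_toFinset_sum _ hfinC]
  refine Finset.sum_congr rfl fun r _ => ?_
  rw [Finset.sum_comm]
  simp only [Finset.sum_ite_eq, Finset.mem_univ, if_true]
  exact sum_contactPairs_eq ((Φ.isTrajectory z hz).mem r) fun k l => tagMark₂ yc yk K (Φ.flow r z) k l

/-! ## §10₂ Assembly: the tagged half with two thresholds from a label-set envelope (port of `…AbnormalActivityTagged` §10) -/

/-- **THE MEAN BOUND AT GIVEN THRESHOLDS** over the per-pair bound `TaggedPerPair₂`: for `σ > 0`, a label-set envelope on `[0, t₁]` with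
`A = C(2π/β)^{3/2} ≥ 1`, thresholds `yc ≥ 100 A`, `yk ≥ 200 A β⁻¹`, `t < t₁`, a cold cap `Θ` and `η > 0`: the minimal scale `K` with
`44 σ³ C² J 2^{-K} ≤ η`; given `τ`, `N₀(τ)` with `w_N < t₁ - t`; for `N ≥ N₀`, `s ≤ t`: speed cap `U`, mesh threshold `M₀`, the window
inequality on `[s, s + w_N]` with the tagged mark, swept-tube events and the majorant `tagMajor₂`, the per-pair bounds
`11 · 2^{-K} C² · 4ε²(w_N/M) J` — mean `≤ (N+1)⁻¹ (σ/τ) (N+1)² · 11 · 2^{-K} C² · 4 ε² w_N J = 44 σ³ C² J 2^{-K} ≤ η`. -/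
theorem lintegral_tagAct₂_le (hPP : TaggedPerPair₂) (hσ : 0 < σ) {a₀ θ₀ : T3 → ℝ} {u₀ : T3 → V3}
    {Φ : (N : ℕ) → Flow σ N} {t t₁ β C : ℝ} (htt₁ : t < t₁) (hβ : 0 < β) (hC : 0 ≤ C)
    (hLE : LabelEnvelopeOn σ a₀ θ₀ u₀ Φ t₁ β C) (hA : 1 ≤ C * (2 * Real.pi / β) ^ (3 / 2 : ℝ))
    {yc : ℝ} (hyc : 100 * (C * (2 * Real.pi / β) ^ (3 / 2 : ℝ)) ≤ yc)
    {yk : ℝ} (hyk : 200 * (C * (2 * Real.pi / β) ^ (3 / 2 : ℝ)) * β⁻¹ ≤ yk) (Θ : ℝ) {η : ℝ} (hη : 0 < η) :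
    ∃ K : ℕ, ∀ τ : ℝ, 0 < τ → ∃ N₀ : ℕ, ∀ N : ℕ, N₀ ≤ N → ∀ s ∈ Set.Icc 0 t,
      ∫⁻ z, ENNReal.ofReal (((N : ℝ) + 1)⁻¹ * ∑ i : Fin (N + 1), tagAct₂ Θ yc yk K (Φ N) τ s i z)
        ∂(localGibbsLaw σ a₀ u₀ θ₀ N (Φ N)) ≤ ENNReal.ofReal η := by
  -- adapted from `taggedSmallOn_of_labelEnvelopeOn` (one threshold) of `…AbnormalActivityTagged`
  classical
  set Z : ℝ≥0∞ := ENNReal.ofReal (4 * σ ^ 3) * (11 * (ENNReal.ofReal (C ^ 2) * fluxJ β)) with hZ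
  have hZtop : Z ≠ ⊤ := ENNReal.mul_ne_top ENNReal.ofReal_ne_top
    (ENNReal.mul_ne_top (by norm_num) (ENNReal.mul_ne_top ENNReal.ofReal_ne_top (fluxJ_lt_top hβ).ne))
  obtain ⟨K, hK1, hK⟩ := exists_scaleK hZtop (ENNReal.ofReal_pos.2 hη)
  refine ⟨K, fun τ hτ => ?_⟩
  obtain ⟨N₀, hN₀⟩ := eventually_window_lt (τ := τ) (t₁ - t) (by linarith)
  refine ⟨N₀, fun N hN s hs => ?_⟩
  set w : ℝ := window τ N with hwdef
  have hw : 0 < w := window_pos hτ N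
  have hwt : w < t₁ - t := hN₀ N hN
  set ε : ℝ := hsDiameter σ N with hεdef
  have hε : 0 < ε := hsDiameter_pos hσ N
  set P : Measure (Cfg N) := localGibbsLaw σ a₀ u₀ θ₀ N (Φ N) with hPdef
  set c' : ℝ≥0∞ := ENNReal.ofReal ((2 * Real.pi / (β / 2)) ^ (3 / 2 : ℝ)) with hc'
  have hFtop : ((N : ℝ≥0∞) + 1) * (1 + ENNReal.ofReal C * c') ≠ ⊤ :=
    ENNReal.mul_ne_top (ENNReal.add_ne_top.2 ⟨ENNReal.natCast_ne_top N, ENNReal.one_ne_top⟩)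
      (ENNReal.add_ne_top.2 ⟨ENNReal.one_ne_top, ENNReal.mul_ne_top ENNReal.ofReal_ne_top ENNReal.ofReal_ne_top⟩)
  have h2pos : (0 : ℝ≥0∞) < 2⁻¹ ^ K := ENNReal.pow_pos (ENNReal.inv_pos.2 ENNReal.ofNat_ne_top) K
  obtain ⟨U, hU, hUcap⟩ := exists_speedCap hβ hFtop h2pos
  have hR1 : 0 < scaleRadius N 1 := scaleRadius_pos N le_rfl
  obtain ⟨M₀, hM₀⟩ := exists_nat_gt (2 * U * w / scaleRadius N 1)
  have hδM : ∀ M : ℕ, M₀ ≤ M → 2 * U * (w / M) ≤ scaleRadius N 1 := by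
    intro M hM
    have hM₀pos : (0 : ℝ) < M₀ := lt_of_le_of_lt (by positivity) hM₀
    have hMM : (M₀ : ℝ) ≤ M := by exact_mod_cast hM
    rw [div_lt_iff₀ hR1] at hM₀
    rw [show 2 * U * (w / M) = 2 * U * w / M by ring, div_le_iff₀ (hM₀pos.trans_le hMM)]
    nlinarith
  have htube : ∀ M : ℕ, ∃ S : V3 → Set V3, MeasurableSet {q : V3 × V3 | q.1 ∈ S q.2} ∧
      (∀ u, volume (S u) ≤ ENNReal.ofReal (4 * ε ^ 2 * (w / M) * ‖u‖)) ∧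
      ∀ (u r : V3) (s : ℝ), ε ≤ ‖r‖ → s ∈ Icc 0 (w / M) → ‖r + s • u‖ = ε → r ∈ S u :=
    fun M => exists_sweptTube hε (div_nonneg hw.le (Nat.cast_nonneg M))
  choose S hSm hSvol hS using htube
  set E : ℕ → Fin (N + 1) → Fin (N + 1) → Set (Cfg N) := fun M k l => windowEvent (S M) k l with hE
  set n : ℝ≥0∞ := ((N + 1 : ℕ) : ℝ≥0∞) with hn
  set Q : ℕ → ℝ≥0∞ := fun M => ENNReal.ofReal (C ^ 2) * (ENNReal.ofReal (4 * ε ^ 2 * (w / M)) * fluxJ β) with hQ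
  set B : ℕ → ℝ≥0∞ := fun M => if M₀ ≤ M then n * n * (11 * 2⁻¹ ^ K * Q M) else ⊤ with hB
  have hBle : ∀ (M : ℕ), ∀ r ∈ Icc s (s + w),
      ∫⁻ x, ∑ k : Fin (N + 1), ∑ l : Fin (N + 1),
        (if k ≠ l then (E M k l).indicator (fun x => tagMajor₂ yc yk (2 * U * (w / M)) U K x k l) x else 0)
          ∂(P.map ((Φ N).flow r)) ≤ B M := by
    intro M r hr
    by_cases hM : M₀ ≤ M
    swap
    · simp only [hB, if_neg hM]; exact le_top
    simp only [hB, if_pos hM]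
    have hr' : r ∈ Icc 0 t₁ := ⟨hs.1.trans hr.1, by linarith [hr.2, hs.2]⟩
    have hLL := hLE N r hr'
    have hεh : 0 ≤ 4 * ε ^ 2 * (w / M) := by positivity
    have hterm : ∀ k l : Fin (N + 1),
        ∫⁻ x, (if k ≠ l then (E M k l).indicator (fun x => tagMajor₂ yc yk (2 * U * (w / M)) U K x k l) x else 0)
          ∂(P.map ((Φ N).flow r)) ≤ 11 * 2⁻¹ ^ K * Q M := by
      intro k l
      by_cases hkl : k ≠ l
      · simp only [if_pos hkl]
        have hind : ∀ x : Cfg N, (E M k l).indicator (fun x => tagMajor₂ yc yk (2 * U * (w / M)) U K x k l) x =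
            tubePair (S M) (x k) (x l) *
              ((if ∃ j, U < ‖(x j).2‖ then 1 else 0) + (if TaggedPlus₂ yc yk (2 * U * (w / M)) K x k then 1 else 0)) :=
          fun x => indicator_windowEvent_eq_tubePair (S M) k l x _
        simp_rw [hind]
        exact hPP hC hβ hLL hkl (hSm M) hεh (hSvol M) hA hyc hyk hK1 (by positivity) (hδM M hM) hU hUcap
      · simp only [if_neg hkl, lintegral_const, zero_mul, zero_le]
    have hmeas : ∀ k l : Fin (N + 1), Measurable fun x : Cfg N =>
        (if k ≠ l then (E M k l).indicator (fun x => tagMajor₂ yc yk (2 * U * (w / M)) U K x k l) x else 0) := by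
      intro k l
      by_cases hkl : k ≠ l
      · simp only [if_pos hkl]
        exact (measurable_tagMajor₂ _ _ _ _ _ k l).indicator (measurableSet_windowEvent (hSm M) k l)
      · simp only [if_neg hkl]; exact measurable_const
    calc _ = ∑ k : Fin (N + 1), ∑ l : Fin (N + 1),
          ∫⁻ x, (if k ≠ l then (E M k l).indicator (fun x => tagMajor₂ yc yk (2 * U * (w / M)) U K x k l) x else 0)
            ∂(P.map ((Φ N).flow r)) := by
          rw [lintegral_finsetSum _ fun k _ => Finset.measurable_sum _ fun l _ => hmeas k l]
          exact Finset.sum_congr rfl fun k _ => lintegral_finsetSum _ fun l _ => hmeas k l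
      _ ≤ ∑ _k : Fin (N + 1), ∑ _l : Fin (N + 1), 11 * 2⁻¹ ^ K * Q M :=
          Finset.sum_le_sum fun k _ => Finset.sum_le_sum fun l _ => hterm k l
      _ = n * n * (11 * 2⁻¹ ^ K * Q M) := by
          simp only [Finset.sum_const, Finset.card_univ, Fintype.card_fin, nsmul_eq_mul, hn]; ring
  obtain ⟨g, hgm, hdom, hint⟩ := exists_measurable_majorant_collisionSum_of_forall_le (Φ N) P hw s
    (fun x k l => tagMark₂ yc yk K x k l) E (fun M k l => measurableSet_windowEvent (hSm M) k l)
    (fun M k l hkl x hx t' ht' hc => mem_windowEvent_of_contact (hS M) hkl hx ht' hc)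
    (fun M x k l => tagMajor₂ yc yk (2 * U * (w / M)) U K x k l) (fun M k l => measurable_tagMajor₂ _ _ _ _ _ k l)
    (fun M k l _ x _ t' ht' _ => tagMark₂_freeFlight_le ht'.1 (mul_le_mul_of_nonneg_left ht'.2 (by positivity)) x k l) B hBle
  set L : ℝ≥0∞ := n * n * (11 * 2⁻¹ ^ K * (ENNReal.ofReal (C ^ 2) * (ENNReal.ofReal (4 * ε ^ 2 * w) * fluxJ β))) with hL
  have hMB : ∀ M : ℕ, max M₀ 1 ≤ M → (M : ℝ≥0∞) * B M = L := by
    intro M hM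
    have hM0' : M₀ ≤ M := le_of_max_le_left hM
    have hkey : (M : ℝ≥0∞) * ENNReal.ofReal (4 * ε ^ 2 * (w / M)) = ENNReal.ofReal (4 * ε ^ 2 * w) := by
      have hM1 : (0 : ℝ) < M := by exact_mod_cast (le_of_max_le_right hM)
      rw [← ENNReal.ofReal_natCast, ← ENNReal.ofReal_mul (Nat.cast_nonneg M)]
      congr 1; field_simp
    simp only [hB, if_pos hM0', hQ, hL]
    rw [← hkey]; ring
  have hlim : liminf (fun M : ℕ => (M : ℝ≥0∞) * B M) atTop ≤ L :=
    liminf_le_of_frequently_le' (((eventually_ge_atTop (max M₀ 1)).mono fun M hM => (hMB M hM).le).frequently)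
  set c₁ : ℝ≥0∞ := ENNReal.ofReal (((N : ℝ) + 1)⁻¹ * (σ / τ)) with hc₁
  have hconst : c₁ * L = Z * 2⁻¹ ^ K := by
    have hn' : n = ENNReal.ofReal ((N : ℝ) + 1) := by
      rw [hn, ← ENNReal.ofReal_natCast]; push_cast; rfl
    have h1 : 0 ≤ ((N : ℝ) + 1)⁻¹ * (σ / τ) := by positivity
    have hreal : ((N : ℝ) + 1)⁻¹ * (σ / τ) * ((N : ℝ) + 1) * ((N : ℝ) + 1) * (4 * ε ^ 2 * w) = 4 * σ ^ 3 := by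
      have hsc : ε ^ 2 * w = σ ^ 2 * τ * ((N : ℝ) + 1)⁻¹ := hsDiameter_sq_mul_window σ τ N
      have hN1 : (N : ℝ) + 1 ≠ 0 := by positivity
      calc ((N : ℝ) + 1)⁻¹ * (σ / τ) * ((N : ℝ) + 1) * ((N : ℝ) + 1) * (4 * ε ^ 2 * w)
          = 4 * (σ / τ) * (((N : ℝ) + 1)⁻¹ * ((N : ℝ) + 1)) * ((N : ℝ) + 1) * (ε ^ 2 * w) := by ring
        _ = 4 * σ ^ 3 := by rw [hsc, inv_mul_cancel₀ hN1]; field_simp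
    have h4 : c₁ * n * n * ENNReal.ofReal (4 * ε ^ 2 * w) = ENNReal.ofReal (4 * σ ^ 3) := by
      rw [hc₁, hn', ← ENNReal.ofReal_mul h1, ← ENNReal.ofReal_mul (by positivity), ← ENNReal.ofReal_mul (by positivity),
        hreal]
    calc c₁ * L = c₁ * n * n * ENNReal.ofReal (4 * ε ^ 2 * w) * (11 * 2⁻¹ ^ K * (ENNReal.ofReal (C ^ 2) * fluxJ β)) := by
          rw [hL]; ring
      _ = Z * 2⁻¹ ^ K := by rw [h4, hZ]; ring
  calc ∫⁻ z, ENNReal.ofReal (((N : ℝ) + 1)⁻¹ * ∑ i : Fin (N + 1), tagAct₂ Θ yc yk K (Φ N) τ s i z) ∂P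
      ≤ ∫⁻ z, c₁ * g z ∂P := by
        refine lintegral_mono_ae ?_
        filter_upwards [ae_mem_good_localGibbsLaw σ a₀ θ₀ u₀ N (Φ N)] with z hz
        exact (ofReal_sum_tagAct₂_le hσ.le Θ yc yk K (Φ N) hτ.le s hz).trans (mul_le_mul' le_rfl (hdom z hz))
    _ = c₁ * ∫⁻ z, g z ∂P := lintegral_const_mul c₁ hgm
    _ ≤ c₁ * L := mul_le_mul' le_rfl (hint.trans hlim)
    _ = Z * 2⁻¹ ^ K := hconst
    _ ≤ ENNReal.ofReal η := hK

/-- **THE TAGGED HALF WITH TWO THRESHOLDS FROM A LABEL-SET ENVELOPE**: for `0 < σ ≤ 1/2`, continuous positive profiles, `0 ≤ t < t₁`,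
`β > 0`, `C ≥ 0` with the TEMPERATURE-FREE clause `C (2π/β)^{3/2} σ³ ≤ 1/100`, a label-set envelope on `[0, t₁]` gives `TaggedSmallOn₂`
on the horizon `t`: `A = C (2π/β)^{3/2} ≥ 1` by total mass, `yc := 100 A` (so `yc σ³ ≤ 1` IS the clause), `yk := 200 A β⁻¹` (free). -/
theorem taggedSmallOn₂_of_labelEnvelopeOn (hPP : TaggedPerPair₂) (hσ : 0 < σ) (hσ2 : σ ≤ 1 / 2) {a₀ θ₀ : T3 → ℝ}
    {u₀ : T3 → V3} (ha : Continuous a₀) (hθ : Continuous θ₀) (hu : Continuous u₀) (ha0 : ∀ x, 0 < a₀ x)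
    (hθ0 : ∀ x, 0 < θ₀ x) {Φ : (N : ℕ) → Flow σ N} {t t₁ β C : ℝ} (ht : 0 ≤ t) (htt₁ : t < t₁) (hβ : 0 < β)
    (hC : 0 ≤ C) (hdil : C * (2 * Real.pi / β) ^ (3 / 2 : ℝ) * σ ^ 3 ≤ 1 / 100)
    (hLE : LabelEnvelopeOn σ a₀ θ₀ u₀ Φ t₁ β C) : TaggedSmallOn₂ σ a₀ θ₀ u₀ Φ t := by
  have hA : 1 ≤ C * (2 * Real.pi / β) ^ (3 / 2 : ℝ) := by
    haveI := isProbabilityMeasure_localGibbsLaw ha hθ hu ha0 hθ0 hσ2 0 (Φ 0)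
    haveI : IsProbabilityMeasure ((localGibbsLaw σ a₀ u₀ θ₀ 0 (Φ 0)).map ((Φ 0).flow 0)) :=
      Measure.isProbabilityMeasure_map ((Φ 0).measurable_flow 0).aemeasurable
    exact one_le_envelopeConst hC hβ (hLE 0 0 ⟨le_rfl, by linarith⟩)
  have hA0 : 0 < C * (2 * Real.pi / β) ^ (3 / 2 : ℝ) := one_pos.trans_le hA
  refine ⟨100 * (C * (2 * Real.pi / β) ^ (3 / 2 : ℝ)), by positivity, ?_, 200 * (C * (2 * Real.pi / β) ^ (3 / 2 : ℝ)) * β⁻¹,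
    by positivity, fun Θ _ η hη => lintegral_tagAct₂_le hPP hσ htt₁ hβ hC hLE hA le_rfl le_rfl Θ hη⟩
  linarith -- the dense-phase range `yc σ³ ≤ 1` IS the temperature-free diluteness clause

/-- **STUB T₂b (line `plaque-thinning-count-ld`), proved** — `stub_taggedFromLabelEnvelopeTT : TaggedPerPair₂ → LabelEnvelopeFromEnvelope →
TaggedFromEnvelope₂`, with `κ₅ = 1/100` and `σ₅ = 1/2`: the label-set envelope of the plumbing hypothesis and the per-pair bound T₂a feed
`taggedSmallOn₂_of_labelEnvelopeOn`. -/
theorem stub_taggedFromLabelEnvelopeTT : TaggedPerPair₂ → LabelEnvelopeFromEnvelope → TaggedFromEnvelope₂ := by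
  intro hPP hL a₀ θ₀ u₀ ha hθ hu ha0 hθ0
  refine ⟨1 / 100, by norm_num, 1 / 2, by norm_num, fun σ hσ hσ5 Φ t t₁ β C ht htt₁ hβ hC hdil hE => ?_⟩
  have hLE := (hL a₀ θ₀ u₀ ha hθ hu ha0 hθ0 σ hσ (by linarith) Φ t₁ β C hC hE).1
  exact taggedSmallOn₂_of_labelEnvelopeOn hPP hσ hσ5.le ha hθ hu ha0 hθ0 ht htt₁ hβ hC hdil hLE

end Summit.AtomisticToContinuum.HydrodynamicLimit.Theorems.CollisionActivityTailsTaggedTT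

end
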